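import Mathlib.RingTheory.RootsOfUnity.PrimitiveRoots   -- `rootsOfUnity`, `rootsOfUnity.isCyclic`, `IsPrimitiveRoot.eq_pow_of_pow_eq_one`
import Mathlib.Analysis.Complex.Basic                     -- `ℂ`
import HarnessLib

/-!
# R90-TF · S3 · THEOREMS — `R90S3AuxGlobaliseCharKeyCyclic` ((U3-χ) brick B1, file F1 of 3): a character of a group that kills the kernel of a
# root-of-unity-valued homomorphism `ζ` is a power of `ι ∘ ζ` — the CYCLIC CORRECTION step of the key of Weil's extension principle

R90-TF section S3 (successor dealer R90-C12-plan (g2), RULING S3-R24 2026-09-05T00:07:10Z «(B1) → K2E3-p21»; census + road R90 bus 00:17:35Z); crux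
H413 (`stmt-HodgeConjecture-24833`, lane `--supports … --as helper`), route `HCCMUnconditional`.  Consumer: file F3 `Theorems/R90S3AuxGlobaliseCharKey.lean`
(`exists_odd_key_of_infCharFamily`, the `hKey` binder of ★ p863377 `auxGlobaliseChar_of_key` behind the (U3-χ) socket `stub_R90_S3_auxGlobaliseChar` of
`Cruxes/H413/Lines/R90_S3_LocalTransportWaveG.lean`).  PURE ALGEBRA (Mathlib only); THEOREMS ONLY (no `def`, no `instance`, no notation, no named fact, no
`sorry`); never imports `Cruxes/…/Lines`.

THE MATHEMATICS [Weil1956 §1 (extension of characters, the finite-cyclic bookkeeping); Rogawski1990 §13.8 p. 216 («`E¹ ∩ ∏_v 𝒪¹_v = μ(E)` … the infinite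
components absorb the roots of unity»)].  Let `G` be a group, `ζ : G → Kˣ` a homomorphism into the units of a field `K` whose values are `N`-th roots of unity,
and `Ψ : G → ℂˣ` a homomorphism with `Ψ = 1` on `ker ζ`.  Then `Ψ` factors through the image `ζ(G) ≤ μ_N(K)`, a subgroup of a finite cyclic group, hence
cyclic with a generator `ζ(g₀)` of order `m`; `Ψ(g₀)` is an `m`-th root of unity in `ℂ`, and for any field embedding `ι : K → ℂ` the primitive `m`-th root
`ι(ζ g₀)` generates all of them, so `Ψ(g₀) = ι(ζ g₀)^s` and therefore `Ψ(g) = ι(ζ g)^s` for EVERY `g`.  In the key of the extension principle (file F3)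
`G` = the group of admissible triples `(a, y, k)`, `ζ(a, y, k) = k ∕ k̄ ∈ μ(L′)`, `Ψ = Ψ_n` the candidate character; the archimedean shift `n ↦ n + 2j`
multiplies `Ψ_n` by `∏_w ι_w(ζ)^{j_w}` and `j := −s·δ_{w₀}` kills it — no parity hypothesis is needed because the correction is RELATIVE to `Ψ_{n₀}`.
* `map_eq_map_zpow_of_ker` — every `ζ g` is a power `ζ g₀ ^ r` of one generator value, with `Ψ g = Ψ g₀ ^ r`.
* **`exists_int_eq_embedding_zpow_of_ker`** — `∃ s : ℤ, ∀ g, Ψ g = ι (ζ g) ^ s`.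
* `exists_update_prod_zpow_mul_eq_one` — the bookkeeping form used by F3: `∃ s, ∀ g, (∏_w ι_w(ζ g)^{(−s·δ_{w₀}) w}) · Ψ g = 1` for a family of
  embeddings `ι_w` indexed by a finite type (the infinite places), `w₀` fixed.

HONEST LABEL: HC_CM is proved only modulo the 7 printed citations (2 remaining named inputs: hLiu418 = stmt-HodgeConjecture-24832, h413 =
stmt-HodgeConjecture-24833) until rung 0 closes; pure algebra toward a GENUINE residual ((U3-χ)); proves nothing printed; count-neutral.

## References
* [Weil1956] A. Weil, *Sur la théorie du corps de classes*, J. Math. Soc. Japan 3 (1951) / *On a certain type of characters of the idèle-class group of an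
  algebraic number-field* (1956), §1.
* [Rogawski1990] J. D. Rogawski, *Automorphic Representations of Unitary Groups in Three Variables*, Ann. of Math. Stud. 123 (1990), §13.8 p. 216.
-/

set_option autoImplicit false
-- the mandated namespace repeats the single-problem summit's segment (`HodgeConjecture.HodgeConjecture`)
set_option linter.dupNamespace false

noncomputable section

namespace Summit.HodgeConjecture.HodgeConjecture.R90.S3

open Finset

variable {G : Type*} [Group G] {K : Type*} [Field K] {N : ℕ} [NeZero N]

/-- **One generator value.**  If `ζ : G →* Kˣ` takes values in the `N`-th roots of unity of the field `K` and `Ψ : G →* ℂˣ` kills `ker ζ`, there is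
`g₀ ∈ G` such that every `g` has `ζ g = ζ g₀ ^ r` and `Ψ g = Ψ g₀ ^ r` for some `r ∈ ℤ` (the image of `ζ` is a subgroup of the finite cyclic group
`μ_N(K)`, hence cyclic). [cite: Weil1956, §1] -/
theorem map_eq_map_zpow_of_ker (ζ : G →* Kˣ) (hζ : ∀ g, ζ g ^ N = 1) (Ψ : G →* ℂˣ) (hΨ : ∀ g, ζ g = 1 → Ψ g = 1) :
    ∃ g₀ : G, ∀ g, ∃ r : ℤ, ζ g = ζ g₀ ^ r ∧ Ψ g = Ψ g₀ ^ r := by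
  classical
  -- corestrict `ζ` to the finite cyclic group `μ_N(K)`
  let ζ' : G →* ↥(rootsOfUnity N K) := ζ.codRestrict (rootsOfUnity N K) fun g => (mem_rootsOfUnity _ _).2 (hζ g)
  have hζ' : ∀ g, ((ζ' g : ↥(rootsOfUnity N K)) : Kˣ) = ζ g := fun _ => rfl
  obtain ⟨x₀, hx₀⟩ := IsCyclic.exists_generator (α := ↥ζ'.range)
  obtain ⟨g₀, hg₀⟩ := MonoidHom.mem_range.1 x₀.2
  refine ⟨g₀, fun g => ?_⟩
  obtain ⟨r, hr⟩ := Subgroup.mem_zpowers_iff.1 (hx₀ ⟨ζ' g, MonoidHom.mem_range.2 ⟨g, rfl⟩⟩)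
  have hζr : ζ g = ζ g₀ ^ r := by
    have h1 := congrArg (fun x : ↥ζ'.range => (((x : ↥(rootsOfUnity N K)) : Kˣ))) hr
    simp only [SubgroupClass.coe_zpow] at h1
    rw [← hζ' g, ← h1, ← hζ' g₀, hg₀]
  refine ⟨r, hζr, ?_⟩
  have hker : ζ (g * (g₀ ^ r)⁻¹) = 1 := by rw [map_mul, map_inv, map_zpow, hζr, mul_inv_cancel]
  have h := hΨ _ hker
  rwa [map_mul, map_inv, map_zpow, mul_inv_eq_one] at h

/-- **CYCLIC CORRECTION.**  If `ζ : G →* Kˣ` takes values in the `N`-th roots of unity of a field `K` and the character `Ψ : G →* ℂˣ` kills `ker ζ`,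
then for any field embedding `ι : K →+* ℂ` there is `s ∈ ℤ` with `Ψ g = ι(ζ g)^s` for every `g` (`Ψ` factors through the cyclic image `⟨ζ g₀⟩` of
order `m`; `Ψ g₀` is an `m`-th root of unity and `ι(ζ g₀)` a PRIMITIVE one). [cite: Weil1956, §1] [cite: Rogawski1990, §13.8 p. 216] -/
theorem exists_int_eq_embedding_zpow_of_ker (ζ : G →* Kˣ) (hζ : ∀ g, ζ g ^ N = 1) (Ψ : G →* ℂˣ)
    (hΨ : ∀ g, ζ g = 1 → Ψ g = 1) (ι : K →+* ℂ) :
    ∃ s : ℤ, ∀ g, ((Ψ g : ℂˣ) : ℂ) = ι ((ζ g : Kˣ) : K) ^ s := by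
  classical
  obtain ⟨g₀, hg₀⟩ := map_eq_map_zpow_of_ker ζ hζ Ψ hΨ
  -- `m = orderOf (ζ g₀)`; `Ψ g₀ ^ m = 1`
  set m : ℕ := orderOf (ζ g₀) with hm
  have hfin : IsOfFinOrder (ζ g₀) := isOfFinOrder_iff_pow_eq_one.2 ⟨N, Nat.pos_of_ne_zero (NeZero.ne N), hζ g₀⟩
  haveI : NeZero m := ⟨(orderOf_pos_iff.2 hfin).ne'⟩
  have hΨm : ((Ψ g₀ : ℂˣ) : ℂ) ^ m = 1 := by
    have hker : ζ (g₀ ^ m) = 1 := by rw [map_pow, hm, pow_orderOf_eq_one]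
    have h := hΨ _ hker
    rw [map_pow] at h
    rw [← Units.val_pow_eq_pow_val, h, Units.val_one]
  -- `ι (ζ g₀)` is a primitive `m`-th root of unity in `ℂ`
  have hprim : IsPrimitiveRoot (ι ((ζ g₀ : Kˣ) : K)) m := by
    have h1 : IsPrimitiveRoot ((ζ g₀ : Kˣ) : K) m :=
      (IsPrimitiveRoot.orderOf (ζ g₀)).map_of_injective (f := Units.coeHom K) Units.val_injective
    exact h1.map_of_injective ι.injective
  obtain ⟨i, -, hi⟩ := hprim.eq_pow_of_pow_eq_one hΨm
  refine ⟨(i : ℤ), fun g => ?_⟩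
  obtain ⟨r, hζr, hΨr⟩ := hg₀ g
  rw [hΨr, hζr, Units.val_zpow_eq_zpow_val, ← hi, Units.val_zpow_eq_zpow_val, map_zpow₀, ← zpow_natCast, ← zpow_mul, ← zpow_mul,
    mul_comm]

/-- **CYCLIC CORRECTION, bookkeeping form.**  Same hypotheses, with a FAMILY of field embeddings `ι_w : K →+* ℂ` indexed by a finite type and a chosen
index `w₀`: there is `s ∈ ℤ` such that the exponent vector `j := Function.update 0 w₀ (−s)` satisfies `(∏_w ι_w(ζ g)^{j w}) · Ψ g = 1` for every `g`
(only the factor at `w₀` is non-trivial).  This is the shape in which file F3 applies the archimedean shift `n ↦ n + 2 j`. [cite: Weil1956, §1] -/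
theorem exists_update_prod_zpow_mul_eq_one {W : Type*} [Fintype W] [DecidableEq W] (ζ : G →* Kˣ) (hζ : ∀ g, ζ g ^ N = 1) (Ψ : G →* ℂˣ)
    (hΨ : ∀ g, ζ g = 1 → Ψ g = 1) (ι : W → (K →+* ℂ)) (w₀ : W) :
    ∃ s : ℤ, ∀ g, (∏ w : W, ι w ((ζ g : Kˣ) : K) ^ (Function.update (0 : W → ℤ) w₀ (-s) w)) * ((Ψ g : ℂˣ) : ℂ) = 1 := by
  obtain ⟨s, hs⟩ := exists_int_eq_embedding_zpow_of_ker ζ hζ Ψ hΨ (ι w₀)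
  refine ⟨s, fun g => ?_⟩
  have hne : ι w₀ ((ζ g : Kˣ) : K) ≠ 0 := by
    rw [map_ne_zero]
    exact (ζ g).ne_zero
  rw [prod_eq_single w₀ (fun w _ hw => by rw [Function.update_of_ne hw, Pi.zero_apply, zpow_zero])
    (fun h => absurd (mem_univ w₀) h), Function.update_self, hs g, zpow_neg, inv_mul_cancel₀ (zpow_ne_zero s hne)]

end Summit.HodgeConjecture.HodgeConjecture.R90.S3

end
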